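import Summits.CriticalPhenomena.PercolationContinuityZ3.Theorems.PercNearOneGluingNoHeavyQuantFarTreeBlockComb
import Summits.CriticalPhenomena.PercolationContinuityZ3.Theorems.PercNearOneGluingNoHeavyQuantBlobWindowVertex
import HarnessLib

/-!
# QUANT lane R8, FAR on trees: block-combs — the far-relay row from prefix window domination AT THE VERTICES of the gate box
# (lead g11's vertex reduction N22 composed with the tree-side identity), and the trivial large-class cases

builds on p205010 (kernel theorem, internal audit signed; external expert review pending)

Support file (`--supports stmt-CriticalPhenomena-4575`), QUANT lane typer seat prim-quant-stmt (gen 14), rung R8 of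
`run/shared/lean/prim/quant/LADDER.md`.  Theorems only; no definitions (the `local notation3`s `CB[a, p, m]` of `…QuantBlobWalk.lean` and
`FW[a, p, K, j, c, m]` of `…QuantBlobWindowVertex.lean`, verbatim), no sorries, standard axioms.

Setting: a block-comb in the gate coordinates of `Quant.FarTreeRow`, enumerated as in `Quant.blockComb_count_eq` (blobs = fibres `Q k` of `P`
off the terminal class, root-first; sizes `sz`, private gates `p`, chain weights `w`, `x = ∏_{P a} q`, terminal size `c`).  After postcont-1
g38's refutation of the blanket window conjectures (`…QuantBlobWindowFalse.lean`), prefix window domination is a per-instance hypothesis; lead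
g11's `BlobWalk.prefixWindow_of_vertices` (N22) reduces it, for gates in `[g, 1]`, to the finitely many gate vectors with values in `{g, 1}`.

* `Quant.farTree_blockComb_of_vertexWindow` — **FAR at layer `j` for a block-comb ⟸ prefix window domination at the `{g,1}`-vertices**:
  `a` least likely (`x ≤ w k · p k`), gates `g ≤ p k` (`k < K`), `2j < EN`, and `FW[sz, q', K, j, c, m] ≥ 0` for every `m ≤ K` and every
  `q'` with `q' k ∈ {g, 1}` (`k < K`) give `P(#{y ∈ A : P y open} ≤ j) ≤ 1 − x`
  (`BlobWalk.exchange_of_vertexWindow` + `Quant.farTree_blockComb_of_exchange`).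
* `Quant.farTree_light_le_of_bigClass` — **the large-class cases are trivial**: if some ancestor set `Q` with `∏_Q q ≥ x` is shared by
  `≥ j + 1` relays of `A`, then `P(#{y ∈ A : P y open} ≤ j) ≤ 1 − x` (the class alone crosses).  So in every window / vertex route one may
  assume all blob sizes and the terminal size `≤ j` — exactly the cap outside which postcont's witnesses live (lane INBOX 2026-08-20T22:04Z:
  every violating vertex class has a blob `≥ j + 2`).
[this work]; [cite: KozmaNitzan2024, Conjecture 3 (p. 15)] (the gluing rows `Quant.FarTreeRow` serves).
-/

noncomputable section

namespace Summit.CriticalPhenomena.PercolationContinuityZ3.Theorems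

namespace Quant

open Finset MeasureTheory
open Literature.Probability.LatticeModels
open Literature.Probability.Percolation
open scoped Classical

/-- `CB[a, p, m] t` = probability that the open mass of the first `m` blobs (sizes `a`, gates `p`) is `≤ t` (the recursion of
`…QuantBlobWalk.lean`, verbatim). -/
local notation3 "CB[" a ", " p ", " m "]" =>
  (Nat.rec (motive := fun _ => ℤ → ℝ) (fun t => if (0 : ℤ) ≤ t then (1 : ℝ) else 0)
    (fun n f t => (p : ℕ → ℝ) n * f (t - ((a : ℕ → ℕ) n : ℤ)) + (1 - (p : ℕ → ℝ) n) * f t) (m : ℕ))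

/-- The prefix window functional `FW[a, p, K, j, c, m]` of `…QuantBlobWindowVertex.lean` (verbatim): opportunities minus dangers among the
first `m` blobs of a `K`-blob block-comb. -/
local notation3 "FW[" a ", " p ", " K ", " j ", " c ", " m "]" =>
  (∑ k ∈ Finset.range (m : ℕ),
    (((Nat.rec (motive := fun _ => ℤ → ℝ) (fun t => if (0 : ℤ) ≤ t then (1 : ℝ) else 0)
        (fun n f t => (p : ℕ → ℝ) n * f (t - ((a : ℕ → ℕ) n : ℤ)) + (1 - (p : ℕ → ℝ) n) * f t) k) (j : ℤ) -
      (Nat.rec (motive := fun _ => ℤ → ℝ) (fun t => if (0 : ℤ) ≤ t then (1 : ℝ) else 0)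
        (fun n f t => (p : ℕ → ℝ) n * f (t - ((a : ℕ → ℕ) n : ℤ)) + (1 - (p : ℕ → ℝ) n) * f t) k) ((j : ℤ) - ((a : ℕ → ℕ) k : ℤ))) -
     ((Nat.rec (motive := fun _ => ℤ → ℝ) (fun t => if (0 : ℤ) ≤ t then (1 : ℝ) else 0)
        (fun n f t => (p : ℕ → ℝ) n * f (t - ((a : ℕ → ℕ) n : ℤ)) + (1 - (p : ℕ → ℝ) n) * f t) k)
          ((j : ℤ) - ((c : ℕ) : ℤ) - ((∑ i ∈ Finset.Ico (k + 1) (K : ℕ), (a : ℕ → ℕ) i : ℕ) : ℤ)) -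
      (Nat.rec (motive := fun _ => ℤ → ℝ) (fun t => if (0 : ℤ) ≤ t then (1 : ℝ) else 0)
        (fun n f t => (p : ℕ → ℝ) n * f (t - ((a : ℕ → ℕ) n : ℤ)) + (1 - (p : ℕ → ℝ) n) * f t) k)
          ((j : ℤ) - ((c : ℕ) : ℤ) - ((∑ i ∈ Finset.Ico (k + 1) (K : ℕ), (a : ℕ → ℕ) i : ℕ) : ℤ) - ((a : ℕ → ℕ) k : ℤ)))))

variable {ι : Type*} [Fintype ι] [DecidableEq ι]

/-- **FAR for a block-comb from prefix window domination at the `{g,1}`-vertices** (lead g11 N22 ∘ the tree-side identity N21 (1)).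
Data as in `Quant.blockComb_count_eq`; `a` least likely (`x ≤ w k · p k`), every private gate `≥ g`, `2j < Σ_{y∈A} ∏_{P y} q`; if for every
gate vector `q'` with `q' k ∈ {g, 1}` (`k < K`) and every `m ≤ K` the prefix window functional `FW[sz, q', K, j, c, m]` is `≥ 0`, then
`P(#{y ∈ A : P y open} ≤ j) ≤ 1 − x`. [this work] -/
theorem farTree_blockComb_of_vertexWindow (P : ι → Finset ι) (q : ι → unitInterval) (a : ι) (x : ℝ)
    (hx : x = ∏ y ∈ P a, (q y : ℝ)) (K : ℕ) (A : Finset ι) (Q : ℕ → Finset ι) (sz : ℕ → ℕ) (c : ℕ) (p w : ℕ → ℝ)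
    (ha : a ∈ A) (hc : c = (A.filter fun y => P y = P a).card)
    (hsz : ∀ k, k < K → sz k = (A.filter fun y => P y = Q k).card)
    (hcover : ∀ y ∈ A, P y = P a ∨ ∃ k, k < K ∧ P y = Q k)
    (hQne : ∀ k, k < K → Q k ≠ P a)
    (hinj : ∀ k k', k < K → k' < K → Q k = Q k' → k = k')
    (hmono : ∀ k k', k ≤ k' → k' < K → Q k ∩ P a ⊆ Q k' ∩ P a)
    (hdisj : ∀ k k', k < K → k' < K → k ≠ k' → Q k ∩ Q k' ⊆ P a)
    (hpdef : ∀ k, p k = ∏ y ∈ Q k \ P a, (q y : ℝ))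
    (hwdef : ∀ k, w k = ∏ y ∈ Q k ∩ P a, (q y : ℝ))
    (hxw : ∀ k, k < K → x ≤ w k * p k) (g : ℝ) (hpg : ∀ k, k < K → g ≤ p k) (j : ℕ)
    (hEN : (2 * j : ℝ) < ∑ y ∈ A, ∏ z ∈ P y, (q z : ℝ))
    (hV : ∀ q' : ℕ → ℝ, (∀ k, k < K → q' k = g ∨ q' k = 1) → ∀ m, m ≤ K → 0 ≤ FW[sz, q', K, (j : ℤ), c, m]) :
    (prodBernoulli q).real
        {ω : Set ι | (A.filter fun y => ((P y : Finset ι) : Set ι) ⊆ ω).card ≤ j} ≤ 1 - x := by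
  have hq0 : ∀ y, (0 : ℝ) ≤ q y := fun y => (q y).2.1
  have hq1 : ∀ y, (q y : ℝ) ≤ 1 := fun y => (q y).2.2
  have hprod01 : ∀ s : Finset ι, 0 ≤ ∏ y ∈ s, (q y : ℝ) ∧ ∏ y ∈ s, (q y : ℝ) ≤ 1 := fun s =>
    ⟨Finset.prod_nonneg fun y _ => hq0 y, Finset.prod_le_one (fun y _ => hq0 y) fun y _ => hq1 y⟩
  have hx0 : 0 ≤ x := by rw [hx]; exact (hprod01 _).1
  have hp01 : ∀ k, 0 ≤ p k ∧ p k ≤ 1 := fun k => by rw [hpdef k]; exact hprod01 _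
  have hsum := blockComb_sum_marginals P q a K A Q sz c hc hsz hcover hQne hinj
  refine farTree_blockComb_of_exchange P q a x hx K A Q sz c p w ha hc hsz hcover hQne hinj hmono hdisj hpdef hwdef j ?_
  refine BlobWalk.exchange_of_vertexWindow sz p hp01 g K hpg (j : ℤ) c x w hx0 ?_ ?_ hV
  · intro i k hik hkK
    have hwk : w k ≤ w i := by
      rw [hwdef k, hwdef i]
      exact Finset.prod_le_prod_of_subset_of_le_one (hmono i k hik hkK) (fun y _ => hq0 y) fun y _ _ => hq1 y
    exact (hxw k hkK).trans (mul_le_mul_of_nonneg_right hwk (hp01 k).1)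
  · have hterm : ∀ k ∈ Finset.range K, (sz k : ℝ) * ∏ z ∈ Q k, (q z : ℝ) ≤ (sz k : ℝ) :=
      fun k _ => mul_le_of_le_one_right (Nat.cast_nonneg _) (hprod01 _).2
    have hs := Finset.sum_le_sum hterm
    have hcx : (c : ℝ) * ∏ z ∈ P a, (q z : ℝ) ≤ c := mul_le_of_le_one_right (Nat.cast_nonneg _) (hprod01 _).2
    rw [hsum] at hEN
    have h1 : (2 * j : ℝ) < c + ∑ k ∈ Finset.range K, (sz k : ℝ) := by linarith
    have h2 : 2 * j < c + ∑ k ∈ Finset.range K, sz k := by exact_mod_cast h1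
    have h3 : ((2 * j : ℕ) : ℤ) < ((c + ∑ k ∈ Finset.range K, sz k : ℕ) : ℤ) := Int.ofNat_lt.2 h2
    push_cast at h3 ⊢
    omega

omit [Fintype ι] in
/-- Relays sharing an open ancestor set are all reached: if `Q` is open then `#{y ∈ A : P y open} ≥ #{y ∈ A | P y = Q}`. [folklore] -/
theorem card_fibre_le_card_reached (P : ι → Finset ι) (A : Finset ι) (Q : Finset ι) (ω : Set ι)
    (hQ : ((Q : Finset ι) : Set ι) ⊆ ω) :
    (A.filter fun y => P y = Q).card ≤ (A.filter fun y => ((P y : Finset ι) : Set ι) ⊆ ω).card := by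
  refine Finset.card_le_card fun y hy => ?_
  obtain ⟨hyA, hyQ⟩ := Finset.mem_filter.1 hy
  exact Finset.mem_filter.2 ⟨hyA, by rw [hyQ]; exact hQ⟩

/-- **The large-class cases of FAR are trivial.**  If an ancestor set `Q` with `x ≤ ∏_Q q` is shared by at least `j + 1` relays of `A`, then
`P(#{y ∈ A : P y open} ≤ j) ≤ 1 − x` — so any window/vertex route may assume all blob sizes and the terminal size `≤ j`. [this work] -/
theorem farTree_light_le_of_bigClass (P : ι → Finset ι) (q : ι → unitInterval) (A : Finset ι) (Q : Finset ι) (x : ℝ) (j : ℕ)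
    (hbig : j + 1 ≤ (A.filter fun y => P y = Q).card) (hxQ : x ≤ ∏ y ∈ Q, (q y : ℝ)) :
    (prodBernoulli q).real
        {ω : Set ι | (A.filter fun y => ((P y : Finset ι) : Set ι) ⊆ ω).card ≤ j} ≤ 1 - x := by
  have hmeas : ∀ T : Set (Set ι), MeasurableSet T := fun T => (Set.toFinite T).measurableSet
  -- the light event is contained in the complement of `{Q open}`
  have hsub : {ω : Set ι | (A.filter fun y => ((P y : Finset ι) : Set ι) ⊆ ω).card ≤ j} ⊆
      {ω : Set ι | ((Q : Finset ι) : Set ι) ⊆ ω}ᶜ := by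
    intro ω hω hQ
    have h1 : (A.filter fun y => ((P y : Finset ι) : Set ι) ⊆ ω).card ≤ j := hω
    have h2 := card_fibre_le_card_reached P A Q ω hQ
    omega
  calc (prodBernoulli q).real {ω : Set ι | (A.filter fun y => ((P y : Finset ι) : Set ι) ⊆ ω).card ≤ j}
      ≤ (prodBernoulli q).real {ω : Set ι | ((Q : Finset ι) : Set ι) ⊆ ω}ᶜ := measureReal_mono hsub (measure_ne_top _ _)
    _ = 1 - ∏ y ∈ Q, (q y : ℝ) := by rw [probReal_compl_eq_one_sub (hmeas _), prodBernoulli_real_subset]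
    _ ≤ 1 - x := by linarith

end Quant

end Summit.CriticalPhenomena.PercolationContinuityZ3.Theorems

end
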